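import Mathlib
import Literature.MathematicalPhysics.QuantumFieldTheory.Volkov2017.ImportanceSamplingToy
import HarnessLib

/-!
# Volkov's importance-sampling cases by EXPONENTS, for integrands DOMINATED by the printed toy (PRD 96, 096018 (2017) §III.A cases 1–3 and eq. (eq_ab_disp); §III.B «Deg plays the role of b») — PROVED: on Ω = (0,1]ⁿ, `|f| ≤ C·Π a_j x_j^{a_j−1}` with `a_j > 0` gives a finite MEAN, and with the density `g = Π b_j x_j^{b_j−1}`, `0 < b_j < 2a_j`, a finite SECOND MOMENT `∫ f²/g`

independent recomputation; certified where stated, statistical where stated; no new-physics claim.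

CITATION HEADER (venture `QEDPrecision`, cell `pub-qed`, track TROPICAL seat V3a = `pub-qed-trop-v3-lit-1` gen 9; VALUE-FREE: two
integrability statements about ABSTRACT functions on the unit cube; no Feynman graph, no constant of Volkov's, nothing per Set V family or
word). Companion of `ImportanceSamplingToy.lean` (lit g21/g23: the printed toy `f = Π a_j x_j^{a_j−1}`, `g = Π b_j x_j^{b_j−1}` with the EXACT
closed form (eq_ab_disp) `V(f,g) = Π a_j²/(b_j(2a_j−b_j)) − 1` and the one-dimensional non-integrability for `b ≥ 2a`). What this file adds is
the DOMINATED n-dimensional form the track's oracle reading needs (`tropical/view/V3-VOLKOV-DEGREES.md` §A A.0.7 (i)/(iii), REF-PROTOCOL §1):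
not the toy itself but ANY integrand bounded by a multiple of it has a finite mean when every `a_j > 0`, and a finite second moment under the
toy density when every `2a_j − b_j > 0` — the sufficiency direction of Volkov's "case 2 vs case 3" decided by exponent inequalities alone.

Source [Volkov2017]: S. Volkov, Phys. Rev. D 96, 096018 (2017) = arXiv:1705.05800 (e-print `amm4_mc_arxiv.tex`, HOME
`data/lit/sources/.cache/1705.05800/`), §III.A "Importance sampling", VERBATIM (l.513–533): "Let us consider three cases: 1. The function
f/g is bounded. In this case, we have a stable Monte Carlo convergence: σ ≈ C/√N … 2. f/g is not bounded, but V(f,g) is finite. In this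
case, we have the same convergence rate as N → ∞. However, if N is fixed … 3. V(f,g) is infinite. In this case, we will have unstable
convergence that is slower than C/√N. An adequate error estimation is difficult in this case."; (l.541–559): "Selection of the function g(x)
needs a lot of care. For example, let Ω = [0;1]ⁿ, f(x₁,…,x_n) = a₁…a_n x₁^{a₁−1}…x_n^{a_n−1}, (eq_density_bb) g(x₁,…,x_n) = b₁…b_n
x₁^{b₁−1}…x_n^{b_n−1}, a₁,…,a_n,b₁,…,b_n > 0. In this case, (eq_ab_disp) V(f,g) = a₁²…a_n² / (b₁…b_n (2a₁−b₁)…(2a_n−b_n)) − 1. On the one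
hand, if there exists j such that b_j > 2a_j, then we fall into case 3."; §III.B (l.602–605): "The numbers Deg({j_l,…,j_n}) play the same
role in the sector S_{j₁,…,j_n} as b₁,…,b_n play in (eq_density_bb). Thus, adjusting Deg(s) requires a lot of care: diminishing of them
can lead to infinite σ, but at the same time increasing of them can increase σ essentially."; and (l.607–609, footnote): "At the present
moment, there is no mathematical proof that (17) does not lead to case 3".

WHAT IS PROVED (namespace `Literature.MathematicalPhysics.QuantumFieldTheory.Volkov2017`, the vocabulary `cube`, `fToyN`, `gToyN`,
`sq_div_toy_eq` of the companion file REUSED): `cube_eq_restrict` (the companion's product measure `cube n` IS Lebesgue measure restricted to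
(0,1]ⁿ); `integrable_cube_of_le_prod_rpow` (anything dominated by `K·Π x_j^{e_j−1}` with `e_j > 0` is integrable on the cube);
`sq_div_toyN_eq` ((eq_ab_disp)'s integrand pointwise: `f²/g = (Π a_j²/b_j)·Π x_j^{2a_j−b_j−1}`); **`integrable_of_dominated_fToyN`**
(`|f| ≤ C·fToyN a`, `a_j > 0` ⇒ `f ∈ L¹(Ω)` — the mean; density-free); **`sq_div_gToyN_integrable_of_dominated`** (`|f| ≤ C·fToyN a`,
`0 < b_j < 2a_j` ⇒ `f²/gToyN b ∈ L¹(Ω)` — a finite second moment of the weight `f/g` under `g`, i.e. NOT case 3).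
THE TRACK'S READING (⟦lit⟧, `V3-VOLKOV-DEGREES.md` A.0.7 / A.21.3 (ε); stated, not asserted beyond the theorems): on ONE Hepp sector in
Volkov's variables `t_l = z_{j_l}/z_{j_{l−1}}` (PRD 96 §III.C; `Volkov2017/SectorIntegral.lean`) the normalised sector density is the toy
`g` with `b_l = Deg(s^{[l]})` — the §III.B sentence above — and an integrand whose `|I|·Πz` is `≤ C·Π_l t_l^{a_l}` on the sector is, as a
density in `t`, dominated by `(C/Πa)·fToyN a`; so the two theorems read: `a_l > 0` on every edge ⇒ the sector's contribution to the MEAN is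
finite; `2a_l − Deg_l > 0` on every edge ⇒ its contribution to `∫ I²/g` is finite (REF §1's "E-true > 0" and "2·E-true − E-dens > 0").
NOT typed: the necessity direction in n dimensions for integrands bounded BELOW by the toy (the companion has the one-dimensional exact
case `secondMoment_toy_not_integrable`); the change of variables from a sector of the simplex to `t` (that is `SectorIntegral.lean` /
`Borinsky2020/HeppSectorCoordinates.lean`); anything about Volkov's actual `Deg`. 0 named facts.
-/

noncomputable section

open MeasureTheory Set Filter

namespace Literature.MathematicalPhysics.QuantumFieldTheory.Volkov2017

variable {n : ℕ}

/-- The companion file's product measure `cube n` (Ω = (0,1]ⁿ) is Lebesgue measure restricted to the cube `Π (0,1]`.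
[cite: Volkov2017, §III.A «let Ω = [0;1]ⁿ» (l.541)] -/
theorem cube_eq_restrict :
    cube n = (volume : Measure (Fin n → ℝ)).restrict (Set.pi Set.univ fun _ => Set.Ioc (0 : ℝ) 1) := by
  rw [cube, volume_pi, Measure.restrict_pi_pi]

/-- `cube n`-almost every point lies in (0,1]ⁿ. [folklore] -/
private theorem ae_cube_mem : ∀ᵐ x ∂(cube n), ∀ j, x j ∈ Set.Ioc (0 : ℝ) 1 := by
  rw [cube_eq_restrict]
  filter_upwards [ae_restrict_mem (MeasurableSet.univ_pi fun _ => measurableSet_Ioc)] with x hx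
  exact fun j => hx j (Set.mem_univ j)

/-- `Π_j x_j^{e_j−1}` is integrable on Ω for `e_j > 0` — the finiteness half of (eq_ab_disp)'s computation (`∫₀¹ x^{e−1} dx = 1/e`).
[cite: Volkov2017, §III.A (eq_ab_disp, l.549–553)] -/
theorem integrable_cube_prod_rpow (e : Fin n → ℝ) (he : ∀ j, 0 < e j) :
    Integrable (fun x : Fin n → ℝ => ∏ j, x j ^ (e j - 1)) (cube n) := by
  unfold cube
  exact Integrable.fintype_prod (f := fun j => fun t : ℝ => t ^ (e j - 1)) fun j =>
    (intervalIntegrable_iff_integrableOn_Ioc_of_le zero_le_one).1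
      (intervalIntegral.intervalIntegrable_rpow' (by linarith [he j]))

/-- Anything a.e.-measurable and dominated by `K·Π_j x_j^{e_j−1}` with `e_j > 0` is integrable on Ω.
[cite: Volkov2017, §III.A (eq_ab_disp, l.549–553)] -/
theorem integrable_cube_of_le_prod_rpow {G : (Fin n → ℝ) → ℝ} (hG : AEStronglyMeasurable G (cube n))
    {K : ℝ} {e : Fin n → ℝ} (he : ∀ j, 0 < e j)
    (hle : ∀ x : Fin n → ℝ, (∀ j, x j ∈ Set.Ioc (0 : ℝ) 1) → |G x| ≤ K * ∏ j, x j ^ (e j - 1)) :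
    Integrable G (cube n) :=
  Integrable.mono' ((integrable_cube_prod_rpow e he).const_mul K) hG
    (ae_cube_mem.mono fun x hx => by rw [Real.norm_eq_abs]; exact hle x hx)

/-- `fToyN a x = (Π a_j)·Π x_j^{a_j−1}`. [folklore] -/
private theorem fToyN_eq_prod (a x : Fin n → ℝ) : fToyN a x = (∏ j, a j) * ∏ j, x j ^ (a j - 1) := by
  unfold fToyN fToy
  rw [← Finset.prod_mul_distrib]

/-- (eq_ab_disp)'s integrand pointwise on the open orthant: `f²/g = (Π_j a_j²/b_j)·Π_j x_j^{2a_j−b_j−1}` (the companion's one-dimensional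
`sq_div_toy_eq` coordinate by coordinate). [cite: Volkov2017, §III.A (eq_ab_disp, l.549–553)] -/
theorem sq_div_toyN_eq (a b x : Fin n → ℝ) (hx : ∀ j, 0 < x j) (hb : ∀ j, b j ≠ 0) :
    fToyN a x ^ 2 / gToyN b x = (∏ j, a j ^ 2 / b j) * ∏ j, x j ^ (2 * a j - b j - 1) := by
  unfold fToyN gToyN
  rw [← Finset.prod_pow, ← Finset.prod_div_distrib, ← Finset.prod_mul_distrib]
  exact Finset.prod_congr rfl fun j _ => sq_div_toy_eq _ _ _ (hx j) (hb j)

/-- The toy density is positive on the open orthant. [folklore] -/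
private theorem gToyN_pos (b x : Fin n → ℝ) (hb : ∀ j, 0 < b j) (hx : ∀ j, 0 < x j) : 0 < gToyN b x := by
  unfold gToyN gToy
  exact Finset.prod_pos fun j _ => mul_pos (hb j) (Real.rpow_pos_of_pos (hx j) _)

/-- The toy integrand is non-negative on the open orthant. [folklore] -/
private theorem fToyN_nonneg (a x : Fin n → ℝ) (ha : ∀ j, 0 < a j) (hx : ∀ j, 0 < x j) : 0 ≤ fToyN a x := by
  unfold fToyN fToy
  exact Finset.prod_nonneg fun j _ => mul_nonneg (ha j).le (Real.rpow_nonneg (hx j).le _)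

/-- The toy density is measurable. [folklore] -/
private theorem measurable_gToyN (b : Fin n → ℝ) : Measurable (gToyN b) := by
  unfold gToyN gToy
  exact Finset.measurable_prod _ fun j _ => ((measurable_pi_apply j).pow_const _).const_mul _

/-- **Finite MEAN by exponents (dominated form)**: if `|f| ≤ C·Π a_j x_j^{a_j−1}` on Ω with every `a_j > 0`, then `f ∈ L¹(Ω)` — whatever
the sampling density. [cite: Volkov2017, §III.A (l.541–549: f = Π a_j x_j^{a_j−1}, a_j > 0, ∫_Ω f = 1)] -/
theorem integrable_of_dominated_fToyN {f : (Fin n → ℝ) → ℝ} (hf : AEStronglyMeasurable f (cube n))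
    {C : ℝ} {a : Fin n → ℝ} (ha : ∀ j, 0 < a j)
    (hle : ∀ x : Fin n → ℝ, (∀ j, x j ∈ Set.Ioc (0 : ℝ) 1) → |f x| ≤ C * fToyN a x) :
    Integrable f (cube n) := by
  refine integrable_cube_of_le_prod_rpow hf (K := C * ∏ j, a j) ha fun x hx => ?_
  rw [mul_assoc, ← fToyN_eq_prod]
  exact hle x hx

/-- **NOT case 3, by exponents (dominated form of (eq_ab_disp))**: if `|f| ≤ C·Π a_j x_j^{a_j−1}` on Ω and the density is
`g = Π b_j x_j^{b_j−1}` with `0 < b_j < 2a_j` for every `j`, then `f²/g ∈ L¹(Ω)`: the second moment of the weight `f/g` under `g` is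
finite («if there exists j such that b_j > 2a_j, then we fall into case 3» is the printed converse for the exact toy; §III.B: the sector
exponents `Deg` «play the same role … as b₁,…,b_n»). [cite: Volkov2017, §III.A cases 1–3 (l.513–533) and (eq_ab_disp) (l.541–559); §III.B (l.602–605)] -/
theorem sq_div_gToyN_integrable_of_dominated {f : (Fin n → ℝ) → ℝ}
    (hf : AEStronglyMeasurable f (cube n)) {C : ℝ} {a b : Fin n → ℝ}
    (hb : ∀ j, 0 < b j) (h2 : ∀ j, b j < 2 * a j)
    (hle : ∀ x : Fin n → ℝ, (∀ j, x j ∈ Set.Ioc (0 : ℝ) 1) → |f x| ≤ C * fToyN a x) :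
    Integrable (fun x => f x ^ 2 / gToyN b x) (cube n) := by
  have ha : ∀ j, 0 < a j := fun j => by linarith [hb j, h2 j]
  have hmeas : AEStronglyMeasurable (fun x => f x ^ 2 / gToyN b x) (cube n) :=
    ((hf.aemeasurable.pow_const 2).div (measurable_gToyN b).aemeasurable).aestronglyMeasurable
  refine integrable_cube_of_le_prod_rpow hmeas (K := C ^ 2 * ∏ j, a j ^ 2 / b j)
    (e := fun j => 2 * a j - b j) (fun j => by linarith [h2 j]) fun x hx => ?_
  have hx0 : ∀ j, 0 < x j := fun j => (hx j).1
  have hg : 0 < gToyN b x := gToyN_pos b x hb hx0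
  have hfx := hle x hx
  have hCf : 0 ≤ C * fToyN a x := (abs_nonneg _).trans hfx
  have hsq : f x ^ 2 ≤ (C * fToyN a x) ^ 2 := by
    rw [← sq_abs (f x)]
    exact pow_le_pow_left₀ (abs_nonneg _) hfx 2
  rw [abs_of_nonneg (div_nonneg (sq_nonneg _) hg.le)]
  calc f x ^ 2 / gToyN b x ≤ (C * fToyN a x) ^ 2 / gToyN b x :=
        div_le_div_of_nonneg_right hsq hg.le
    _ = C ^ 2 * (fToyN a x ^ 2 / gToyN b x) := by ring
    _ = C ^ 2 * ((∏ j, a j ^ 2 / b j) * ∏ j, x j ^ (2 * a j - b j - 1)) := by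
        rw [sq_div_toyN_eq a b x hx0 fun j => (hb j).ne']
    _ = C ^ 2 * (∏ j, a j ^ 2 / b j) * ∏ j, x j ^ (2 * a j - b j - 1) := by ring

end Literature.MathematicalPhysics.QuantumFieldTheory.Volkov2017
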